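import Summits.NavierStokesRegularity.NavierStokesRegularity.Theorems.ScenarioCensusRowF19peakDoor

/-!
# Census row F19 family, peak members — part 4/4: §7 the lattice ON CLASSICAL SOLUTIONS (the peak identity and the
# hypothesis edges), and the CENSUS KEYS `Row_F19gp` / `Row_F19ig` / `Row_F1peak` (+ `_excluded`)

Re-homed for the scenario census (typer seat ns-census-typer-1 g6; lead g8 GO 2026-08-28T18:54Z, OPTIONAL (3) «F19 peak members»:
PORT of ns-idea-3 LINE 13 «peak-push» REV 3, `pub/ideators/ns-idea-3/lines/peak-push/line-peak-push.rev3.lean`, sha16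
191fe95c2723e21c, 991 l., §1–§7 — REV 4 = REV 3 + §8 «pressure-force rows», NOT ported now; lean check rc 0, 0 sorry; ref g7
PRE-CHECK ✓ §12.31; critic idea-crit-3 RE-STAMPs 17:19:45Z / 17:22:09Z; lead g7 BOOKINGS 17:28Z: MEMBERS OF RECORD of the F19
family row = G-peak, IG-peak, F1peak — TREE records under ROW POLICY 15:11Z / cen9 (2), no new row, no value change), split for
the 400-line rule into `ScenarioCensusRowF19peakTop` (§1–§3: speed peaks, criteria, rows, the curved moving level, the
first-crossing lemma) → `ScenarioCensusRowF19peakFloor` (§4–§5: the peak-push floor from row F1a BY NAME, rows P/G/G-lab/F1peak,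
residual) → `ScenarioCensusRowF19peakDoor` (§6: the integral door, rows I/IG/PG-peak) → `ScenarioCensusRowF19peak` (§7: the
lattice on classical solutions; census keys).  Lean text VERBATIM in namespace `…Theorems.ScenarioCensus.PeakPush` (the line's
`…Cruxes.ScenarioCensusRowF1.PeakPushLine` re-homed); the three real-variable tools identical to LINE 11's (`deltaStar_pos`,
`kappa_mul_lt_one`, `hasDerivAt_inv_sqrt_sub`) are taken from the tree's F19 port (`ScenarioCensus.QuasiSteadyTop`,
`ScenarioCensusRowF19Top.lean`) instead of being restated; one bib key corrected (`Tao2013Localisation`); the `[folklore]`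
tags of the parameterless row `def`s dropped (gate relocation rule); one-line docstrings added to six undocumented auxiliaries.

This part: the peak identity `inner_timeDeriv_le_netPush_of_isSpeedPeak` (`⟪u,∂ₜu⟫ ≤ −ν|Du|²_F − ⟪u,∇p⟫` at every global speed
argmax, interior time, classical solution with zero force) and its consequences `hasSubcriticalPeakGain_of_push`,
`hasDominatedPeakGain_of_push`, `hasSubcriticalPeakGain_of_noDoublySupercritical`, `hasNoDoublySupercriticalPeak_iff_gain`, the
kit edges `rowPpeak_of_rowGpeak`, `rowIpeak_of_rowIGpeak`, `rowPGpeak_of_rowGpeak`, `rowPGpeak_iff_rowGpeak` (on solutions the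
push hypotheses are SUB-CASES of the gain hypotheses; the two genuinely distinct excluded classes are G-peak and IG-peak).
Then the census keys (namespace `…Theorems.ScenarioCensus`, lead g8 18:54Z [2/2]; each an alias BY NAME of the line's decl +
its `_excluded` closer): `Row_F19gp` (= `PeakPush.Row_Gpeak`), `Row_F19ig` (= `PeakPush.Row_IGpeak`), `Row_F1peak`
(= `PeakPush.Row_F1peak`, Type-I member).  Record-only members of the F19 family row (census FROZEN v1.62, cen9 (2)).

No census value is asserted here (the lead books the F19 family); NS regularity is NOT proved; `Row_F1` stays open
(≡ `TypeIPeakModeration`); no summit statement is proved by this file.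
-/

noncomputable section

set_option linter.dupNamespace false

open MeasureTheory Set Function Filter TopologicalSpace Metric
open scoped Topology NNReal ENNReal Laplacian RealInnerProductSpace

namespace Summit.NavierStokesRegularity.NavierStokesRegularity.Theorems.ScenarioCensus.PeakPush

open Literature.Analysis Literature.Analysis.FluidPDE
open Summit.NavierStokesRegularity.NavierStokesRegularity.Theorems
open Summit.NavierStokesRegularity.FluidComputer.PalasekTowerClayBridge

variable {ν T : ℝ} {u : ℝ → E3 → E3} {p : ℝ → E3 → ℝ}

/-! ## §7 (REV 3) The lattice ON CLASSICAL SOLUTIONS: the peak identity and the hypothesis edges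

Card rev 2a's erratum made kernel.  At every spatial argmax of the speed of a classical solution the
speed GAIN is at most the NET pressure push: `⟪u,∂ₜu⟫ ≤ −ν|Du|²_F − ⟪u,∇p⟫` (momentum equation,
`⟪u,(u·∇)u⟫ = 0` and `Δ|u|² ≤ 0` at the maximum).  Consequently, on classical solutions: subcritical
(resp. dominated) peak PUSH implies subcritical (resp. dominated) peak GAIN, and «no doubly supercritical
peak» is EQUIVALENT to subcritical peak gain.  So the genuinely distinct hypothesis classes of the family
are `HasSubcriticalPeakGain` (critical clock, small constant) and `HasDominatedPeakGain` (clock with a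
bounded primitive, any size); the push versions are their pressure-only sub-cases and `Row_PGpeak` is an
alias of `Row_Gpeak`.  (As hypothesis classes on ARBITRARY fields `(u,p)` no such implications hold.) -/

/-- **The peak identity.**  Classical solution on `[0,T) × ℝ³` (zero force, `ν ≥ 0`), interior time
`t₀ ∈ (0,T)`, `x₀` a global spatial argmax of the speed: the speed gain is at most the net pressure push,
`⟪u, ∂ₜu⟫ ≤ −ν|Du|²_F − ⟪u, ∇p⟫` at `(t₀,x₀)`.  Same static ingredients as the tree's
`HittingCalculus.hitting_inequality_drift` (`inner_fderiv_eq_zero_of_isMax`, `laplacian_nonpos_of_isLocalMax`,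
`laplacian_inner_self_eq`), without any moving level. [cite: GilbargTrudinger2001, §3.1] -/
theorem inner_timeDeriv_le_netPush_of_isSpeedPeak (hsol : IsClassicalNSSolutionOn (Ico 0 T) ν 0 u p)
    (hν : 0 ≤ ν) {t₀ : ℝ} (ht₀ : t₀ ∈ Ioo 0 T) {x₀ : E3} (hmax : IsSpeedPeak u t₀ x₀) :
    ⟪u t₀ x₀, timeDerivWithin (Ico 0 T) u t₀ x₀⟫ ≤
      -(ν * frobeniusNormSq (fderiv ℝ (u t₀) x₀)) - ⟪u t₀ x₀, gradient (p t₀) x₀⟫ := by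
  have ht₀' : t₀ ∈ Ico 0 T := ⟨ht₀.1.le, ht₀.2⟩
  have ht₀₂ : t₀ < (t₀ + T) / 2 := by linarith [ht₀.2]
  have ht₂T : (t₀ + T) / 2 < T := by linarith [ht₀.2]
  have ht₂0 : 0 < (t₀ + T) / 2 := ht₀.1.trans ht₀₂
  have hsolc : IsClassicalNSSolutionOn (Icc 0 ((t₀ + T) / 2)) ν 0 u p :=
    hsol.mono (Icc_subset_Ico_right ht₂T) (uniqueDiffOn_Icc ht₂0)
  have hmom := hsol.momentum t₀ ht₀' x₀
  have hD : timeDerivWithin (Ico 0 T) u t₀ x₀ =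
      ν • Δ (u t₀) x₀ - gradient (p t₀) x₀ + (0 : ℝ → E3 → E3) t₀ x₀ - convect (u t₀) (u t₀) x₀ := by
    rw [← hmom]; abel
  have hconv : ⟪u t₀ x₀, convect (u t₀) (u t₀) x₀⟫ = 0 := by
    rw [convect_apply]
    exact HittingCalculus.inner_fderiv_eq_zero_of_isMax hsolc ⟨ht₀.1.le, ht₀₂.le⟩ (fun y => hmax y) _
  have hzero : ⟪u t₀ x₀, (0 : ℝ → E3 → E3) t₀ x₀⟫ = 0 := by simp
  set U := u t₀ with hU
  have hC2 : ContDiff ℝ 2 U := (hsol.contDiff_velocity ht₀').of_le (by norm_cast)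
  have hloc : IsLocalMax (fun x => ⟪U x, U x⟫) x₀ := by
    have h' : IsLocalMax (fun x => ‖U x‖ ^ 2) x₀ :=
      Filter.Eventually.of_forall fun x => pow_le_pow_left₀ (norm_nonneg _) (hmax x) 2
    simpa only [real_inner_self_eq_norm_sq] using h'
  have hΔ : (Δ fun y => ⟪U y, U y⟫) x₀ ≤ 0 := laplacian_nonpos_of_isLocalMax (hC2.inner ℝ hC2) hloc
  rw [laplacian_inner_self_eq hC2 x₀, real_inner_comm] at hΔ
  have h3 : ν * ⟪U x₀, Δ U x₀⟫ ≤ ν * (- frobeniusNormSq (fderiv ℝ U x₀)) :=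
    mul_le_mul_of_nonneg_left (by linarith) hν
  rw [hD, inner_sub_right, inner_add_right, inner_sub_right, real_inner_smul_right, hconv, hzero]
  linarith

/-- Edge on solutions: subcritical peak PUSH ⇒ subcritical peak GAIN (same `δ`). [folklore] -/
theorem hasSubcriticalPeakGain_of_push (hT : 0 < T) (hsol : IsClassicalNSSolutionOn (Ico 0 T) ν 0 u p)
    (hν : 0 ≤ ν) {δ : ℝ} (h : HasSubcriticalPeakPush ν T δ u p) : HasSubcriticalPeakGain ν T δ u := by
  obtain ⟨Λ, hΛ⟩ := h
  refine ⟨Λ, ?_⟩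
  filter_upwards [hΛ, Ioo_mem_nhdsLT hT] with t ht htI x hx hfast
  have hid := inner_timeDeriv_le_netPush_of_isSpeedPeak hsol hν htI hx
  linarith [ht x hx hfast]

/-- Edge on solutions: dominated peak PUSH ⇒ dominated peak GAIN (same clock). [folklore] -/
theorem hasDominatedPeakGain_of_push (hT : 0 < T) (hsol : IsClassicalNSSolutionOn (Ico 0 T) ν 0 u p)
    (hν : 0 ≤ ν) (h : HasDominatedPeakPush ν T u p) : HasDominatedPeakGain T u := by
  obtain ⟨Λ, B, T₀, G, g, hT₀, hG, hGB, hΛ⟩ := h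
  refine ⟨Λ, B, T₀, G, g, hT₀, hG, hGB, ?_⟩
  filter_upwards [hΛ, Ioo_mem_nhdsLT hT] with t ht htI x hx hfast
  have hid := inner_timeDeriv_le_netPush_of_isSpeedPeak hsol hν htI hx
  linarith [ht x hx hfast]

/-- Edge on solutions: «no doubly supercritical peak» ⇒ subcritical peak GAIN (same `δ`): the joint
hypothesis is an alias of the gain hypothesis on classical solutions. [folklore] -/
theorem hasSubcriticalPeakGain_of_noDoublySupercritical (hT : 0 < T)
    (hsol : IsClassicalNSSolutionOn (Ico 0 T) ν 0 u p) (hν : 0 ≤ ν) {δ : ℝ}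
    (h : HasNoDoublySupercriticalPeak ν T δ u p) : HasSubcriticalPeakGain ν T δ u := by
  obtain ⟨Λ, hΛ⟩ := h
  refine ⟨Λ, ?_⟩
  filter_upwards [hΛ, Ioo_mem_nhdsLT hT] with t ht htI x hx hfast
  have hid := inner_timeDeriv_le_netPush_of_isSpeedPeak hsol hν htI hx
  rcases ht x hx hfast with hpush | hgain
  · linarith
  · exact hgain

/-- The alias in kernel: on classical solutions «no doubly supercritical peak» ⟺ subcritical peak gain.
[folklore] -/
theorem hasNoDoublySupercriticalPeak_iff_gain (hT : 0 < T)
    (hsol : IsClassicalNSSolutionOn (Ico 0 T) ν 0 u p) (hν : 0 ≤ ν) {δ : ℝ} :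
    HasNoDoublySupercriticalPeak ν T δ u p ↔ HasSubcriticalPeakGain ν T δ u :=
  ⟨hasSubcriticalPeakGain_of_noDoublySupercritical hT hsol hν, hasNoDoublySupercriticalPeak_of_gain⟩

/-- Row edges BY THE LATTICE (independently of the floors): G-peak ⇒ P-peak, IG-peak ⇒ I-peak,
G-peak ⇒ PG-peak. [folklore] -/
theorem rowPpeak_of_rowGpeak (h : Row_Gpeak) : Row_Ppeak :=
  fun ν T δ hν hT hδ hδlt u p hsol hLH hdec hP =>
    h ν T δ hν hT hδ hδlt u p hsol hLH hdec (hasSubcriticalPeakGain_of_push hT hsol hν.le hP)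

/-- IG-peak ⇒ I-peak on solutions (the push hypothesis is the pressure-only sub-case). [folklore] -/
theorem rowIpeak_of_rowIGpeak (h : Row_IGpeak) : Row_Ipeak :=
  fun ν T hν hT u p hsol hLH hdec hP =>
    h ν T hν hT u p hsol hLH hdec (hasDominatedPeakGain_of_push hT hsol hν.le hP)

/-- G-peak ⇒ PG-peak on solutions (the joint hypothesis is an alias of the gain hypothesis). [folklore] -/
theorem rowPGpeak_of_rowGpeak (h : Row_Gpeak) : Row_PGpeak :=
  fun ν T δ hν hT hδ hδlt u p hsol hLH hdec hPG =>
    h ν T δ hν hT hδ hδlt u p hsol hLH hdec (hasSubcriticalPeakGain_of_noDoublySupercritical hT hsol hν.le hPG)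

/-- `Row_PGpeak ↔ Row_Gpeak` (alias). [folklore] -/
theorem rowPGpeak_iff_rowGpeak : Row_PGpeak ↔ Row_Gpeak := ⟨rowGpeak_of_rowPGpeak, rowPGpeak_of_rowGpeak⟩

end Summit.NavierStokesRegularity.NavierStokesRegularity.Theorems.ScenarioCensus.PeakPush

/-! ## Census keys (F19 family, peak members of record: G-peak, IG-peak, F1peak) -/

namespace Summit.NavierStokesRegularity.NavierStokesRegularity.Theorems.ScenarioCensus

/-- F19 family member F19gp «G-peak» — (I ∨ II, NO rate · forward, Clay frame of rows F0 / F1a VERBATIM · no symmetry; instead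
SUBCRITICAL PEAK GAIN: at every fast GLOBAL SPEED PEAK near `T`, `⟪u, ∂ₜu⟫ ≤ δ√ν (T−t)^{-3/2}|u|`, `0 ≤ δ < 9 − 2√15`): extends
past `T`, BY NAME `PeakPush.Row_Gpeak` (ns-idea-3 LINE 13 REV 3, VERBATIM).  Closed by `row_F19gp_excluded`; the lead books it
as a member of record of row F19 (no new row). -/
def Row_F19gp : Prop := PeakPush.Row_Gpeak

/-- F19gp is PROVED in the tree: `PeakPush.rowGpeak_holds` (first crossing of the curved moving speed level at a global argmax +
row F1a BY NAME).  No summit proved. -/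
theorem row_F19gp_excluded : Row_F19gp := PeakPush.rowGpeak_holds

/-- F19 family member F19ig «IG-peak» — (same frame; instead DOMINATED PEAK GAIN: on a final window some clock `g` with a BOUNDED
PRIMITIVE dominates the speed gain at the fast speed peaks, `⟪u, ∂ₜu⟫ ≤ g(t)|u|`, `g` of ANY size — incomparable with G-peak):
extends past `T`, BY NAME `PeakPush.Row_IGpeak`.  Closed by `row_F19ig_excluded`. -/
def Row_F19ig : Prop := PeakPush.Row_IGpeak

/-- F19ig is PROVED in the tree: `PeakPush.rowIGpeak_holds` (the integral door at the speed peak).  No summit proved. -/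
theorem row_F19ig_excluded : Row_F19ig := PeakPush.rowIGpeak_holds

/-- F19 family Type-I member F1peak — (Type I `IsTypeIBlowup u T` · forward, Clay frame · subcritically PUSHED peaks
`−⟪u, ∇p⟫ ≤ ν|Du|²_F + δ√ν (T−t)^{-3/2}|u|` at the fast speed peaks, `0 ≤ δ < 9 − 2√15`): extends past `T`, BY NAME
`PeakPush.Row_F1peak` (a member of row F1's split; `Row_F1` itself stays OPEN ≡ `PeakPush.TypeIPeakModeration`).  Closed by
`row_F1peak_excluded`. -/
def Row_F1peak : Prop := PeakPush.Row_F1peak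

/-- F1peak is PROVED in the tree: `PeakPush.rowF1peak_holds` (via `Row_Ppeak`).  No summit proved. -/
theorem row_F1peak_excluded : Row_F1peak := PeakPush.rowF1peak_holds

end Summit.NavierStokesRegularity.NavierStokesRegularity.Theorems.ScenarioCensus

end
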